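import Literature.Topology.FourManifolds.BranchedDoubleCoverTwoKnot
import Literature.Topology.FourManifolds.GluckTwistUnknotProofs
import Literature.Topology.FourManifolds.KnotsProofs
import Literature.Topology.FourManifolds.WhitneyModelSheets
import Mathlib.Analysis.InnerProductSpace.Calculus
import HarnessLib

/-!
# The 4-sphere is the branched double cover of itself along the unknotted 2-sphere, with deck
# involution the linear half-turn (Miyazawa 2023, proof of Prop. 3.14) — non-vacuity of
# `IsBranchedDoubleCover`

Topic `Literature/Topology/FourManifolds`. Companion of the definition file
`BranchedDoubleCoverTwoKnot.lean` (`IsBranchedDoubleCover IX X K ι q`): the STANDARD EXAMPLE.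
Write `S⁴ ⊆ ℝ⁵ = ℝ³ × ℝ²` (`headThree`, `tailTwo`, `appendFive` of `GluckTwistUnknotProofs.lean`)
and let `U = S⁴ ∩ (ℝ³ × {0})` be the unknotted 2-sphere (`unknotTwo`). Then

* the **linear half-turn** `ι (y, v) = (y, -v)` (`halfTurn`; rotation by `π` in the normal
  plane of `U`, fixed-point set exactly `U`), and
* the **fold map** `q (y, v) = (y, v²) / ‖(y, v²)‖` (`fold`; `v² ∈ ℝ² ≅ ℂ` the complex square,
  `normalSq`)

make `(S⁴, ι, q)` a branched double cover of `S⁴` along `U` in the sense of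
`IsBranchedDoubleCover (𝓡 4) (𝕊 4) unknotTwo halfTurn fold`
(`isBranchedDoubleCover_sphere_unknotTwo`). This is the sentence "One can easily check that
`Σ₂(S⁴, U)` is diffeomorphic to `S⁴` and the covering transformation `ι : (ℝ⁴)⁺ → (ℝ⁴)⁺` is
induced by `(x₁, x₂, x₃, x₄) ↦ (x₁, x₂, -x₃, -x₄)`" of Miyazawa, arXiv:2312.02041, proof of
Prop. 3.14 (p. 24), in the compact model `S⁴ ⊆ ℝ³ × ℂ` rather than the one-point
compactification of `ℝ⁴ = ℝ² × ℂ`; it is also the `s = 0` member (`K(2,3,1)` = unknot, whose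
roll-spin is unknotted) of the family of Kuhrman, arXiv:2507.03798, Thm. 1, and it shows that the
relational predicate `IsBranchedDoubleCover` is inhabited.

## The verification (all clauses of the predicate, proved)

* `q ∘ ι = q` since `(-v)² = v²`; `ι` is free exactly off `U = {v = 0}` and `q⁻¹(U) = U`.
* FIBRES: `q y = q x` forces `(y_head, y_tail²) = r (x_head, x_tail²)` with `r > 0`; on the unit
  sphere `r² a + r b = a + b = 1` (`a = ‖x_head‖²`, `b = ‖x_tail‖²`) gives `r = 1`, so
  `y_tail = ± x_tail` (`normalSq_eq_normalSq_iff`), i.e. `y = x` or `y = ι x`.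
* ONTO: for `s = (h, t) ∈ S⁴` put `c = 2 / (‖t‖ + √(‖t‖² + 4‖h‖²)) > 0` (the positive root of
  `‖h‖² c² + ‖t‖ c = 1`) and pick `w` with `w² = c t`; then `(c h, w) ∈ S⁴` folds to `s`.
* LOCAL DIFFEOMORPHISM off `U`: at `x = (h, t)`, `t ≠ 0`, the differential of `q` is injective on
  `T_x S⁴ = x^⊥` — if `d(F/‖F‖)(V) = 0` for `F (y, v) = (y, v²)` then `dF(V) = μ F(x)`, i.e.
  `V = (μ h, μ t / 2)`, and `V ⟂ x` gives `μ (‖h‖² + ‖t‖²/2) = 0`, `μ = 0` — hence `q` is a local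
  diffeomorphism there (inverse function theorem on manifolds, the tree's
  `isLocalDiffeomorphAt_of_mfderiv_injective`, with Mathlib's `mfderiv_coe_sphere_injective`,
  `range_mfderiv_coe_sphere`).
* MODEL: over the tubular neighbourhood `ν (p, u) = (p, u)/‖(p, u)‖` of `U` (`unknotTube`) the
  model embedding is `j (p, w) = ν (p, c(‖w‖²) w)` with `c(s) = √((s + √(s² + 4))/2)`, the
  radial reparametrisation for which `c⁴ = 1 + s c²`, so that
  `q (j (p, w)) = (p, c² w²)/c² ‖·‖ = ν (p, w²)` EXACTLY; `ι (j (p, w)) = j (p, -w)`;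
  `j (S² × ℝ²) = ν (S² × ℝ²) = {y_head ≠ 0} = q⁻¹ {y_head ≠ 0}`; `j` is a smooth embedding with
  open range (a globally defined partial diffeomorphism, inverse `(y, v) ↦ (y/‖y‖, (1 + ‖ṽ‖²)^{-1/4} ṽ)`,
  `ṽ = v/‖y‖`).

## References

* J. Miyazawa, arXiv:2312.02041 (2023), proof of Prop. 3.14 (p. 24). [Miyazawa2023]
* J. Kuhrman, arXiv:2507.03798 (2025), Thm. 1 (`s = 0`) and §2.2. [Kuhrman2025]
* R. E. Gompf, A. I. Stipsicz, *4-Manifolds and Kirby Calculus* (1999), §6.3. [GompfStipsicz1999]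
-/

open scoped Manifold ContDiff Topology InnerProductSpace
open Function Set

noncomputable section

namespace Literature.Topology.FourManifolds

open GluckUnknot

namespace BranchedUnknot

/-- Local notation: `𝔼 n` is the model Euclidean space `EuclideanSpace ℝ (Fin n)`. -/
local notation "𝔼 " n:arg => EuclideanSpace ℝ (Fin n)

/-- Local notation: `𝕊 n` is the unit sphere in `EuclideanSpace ℝ (Fin (n + 1))`. -/
local notation "𝕊 " n:arg => (Metric.sphere (0 : EuclideanSpace ℝ (Fin (n + 1))) 1)

/-! ## Local `Fact` instances for the sphere API -/

/-- `finrank ℝ ℝ³ = 2 + 1` (spelling `Fin 3`). [folklore] -/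
private theorem fact_finrank_three : Fact (Module.finrank ℝ (𝔼 3) = 2 + 1) :=
  ⟨finrank_euclideanSpace_fin⟩

/-- `finrank ℝ ℝ⁵ = 4 + 1` (spelling `Fin 5`). [folklore] -/
private theorem fact_finrank_five : Fact (Module.finrank ℝ (𝔼 5) = 4 + 1) :=
  ⟨finrank_euclideanSpace_fin⟩

/-- `finrank ℝ ℝ³ = 2 + 1` (spelling `Fin (2 + 1)`). [folklore] -/
private theorem fact_finrank_two_add_one :
    Fact (Module.finrank ℝ (EuclideanSpace ℝ (Fin (2 + 1))) = 2 + 1) :=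
  ⟨finrank_euclideanSpace_fin⟩

/-- `finrank ℝ ℝ⁵ = 4 + 1` (spelling `Fin (4 + 1)`). [folklore] -/
private theorem fact_finrank_four_add_one :
    Fact (Module.finrank ℝ (EuclideanSpace ℝ (Fin (4 + 1))) = 4 + 1) :=
  ⟨finrank_euclideanSpace_fin⟩

attribute [local instance] fact_finrank_three fact_finrank_five fact_finrank_two_add_one
  fact_finrank_four_add_one

/-! ## More algebra of the squaring map of the normal plane -/

/-- `‖w²‖ = ‖w‖²`: `(u² - v²)² + (2uv)² = (u² + v²)²`. [folklore] -/
theorem norm_normalSq (w : 𝔼 2) : ‖normalSq w‖ = ‖w‖ ^ 2 := by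
  have h1 : ‖normalSq w‖ ^ 2 = (‖w‖ ^ 2) ^ 2 := by
    simp only [EuclideanSpace.real_norm_sq_eq, Fin.sum_univ_two, normalSq_apply_zero,
      normalSq_apply_one]
    ring
  nlinarith [norm_nonneg (normalSq w), norm_nonneg w, sq_nonneg ‖w‖,
    sq_nonneg (‖normalSq w‖ - ‖w‖ ^ 2), sq_nonneg (‖normalSq w‖ + ‖w‖ ^ 2)]

/-- The squaring map is homogeneous of degree `2`: `(a w)² = a² w²`. [folklore] -/
theorem normalSq_smul (a : ℝ) (w : 𝔼 2) : normalSq (a • w) = (a ^ 2) • normalSq w := by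
  ext i
  fin_cases i <;> simp [normalSq] <;> ring

/-! ## The linear half-turn -/

/-- The half-turn of `ℝ⁵ = ℝ³ × ℝ²`: `(y, v) ↦ (y, -v)`. [folklore] -/
def halfTurnVec (z : 𝔼 5) : 𝔼 5 := appendFive (headThree z) (-tailTwo z)

/-- Head of the half-turn: unchanged. [folklore] -/
@[simp] theorem headThree_halfTurnVec (z : 𝔼 5) : headThree (halfTurnVec z) = headThree z := by
  rw [halfTurnVec, headThree_appendFive]

/-- Tail of the half-turn: negated. [folklore] -/
@[simp] theorem tailTwo_halfTurnVec (z : 𝔼 5) : tailTwo (halfTurnVec z) = -tailTwo z := by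
  rw [halfTurnVec, tailTwo_appendFive]

/-- The half-turn is an isometry: `‖(y, -v)‖ = ‖(y, v)‖`. [folklore] -/
theorem norm_halfTurnVec (z : 𝔼 5) : ‖halfTurnVec z‖ = ‖z‖ := by
  have h1 : ‖halfTurnVec z‖ ^ 2 = ‖z‖ ^ 2 := by
    rw [halfTurnVec, norm_sq_appendFive, norm_neg, norm_sq_eq_headThree_tailTwo z]
  nlinarith [norm_nonneg (halfTurnVec z), norm_nonneg z]

/-- The half-turn is an involution of `ℝ⁵`. [folklore] -/
@[simp] theorem halfTurnVec_halfTurnVec (z : 𝔼 5) : halfTurnVec (halfTurnVec z) = z := by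
  rw [halfTurnVec, headThree_halfTurnVec, tailTwo_halfTurnVec, neg_neg,
    appendFive_headThree_tailTwo]

/-- The half-turn commutes with scalars. [folklore] -/
theorem halfTurnVec_smul (a : ℝ) (z : 𝔼 5) : halfTurnVec (a • z) = a • halfTurnVec z := by
  rw [halfTurnVec, halfTurnVec, headThree_smul, tailTwo_smul, smul_appendFive, smul_neg]

/-- The half-turn is `C^∞` (linear). [folklore] -/
theorem contDiff_halfTurnVec : ContDiff ℝ ∞ halfTurnVec :=
  contDiff_appendFive.comp (contDiff_headThree.prodMk contDiff_tailTwo.neg)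

/-- **The linear half-turn of `S⁴`**: `(x₀, x₁, x₂, x₃, x₄) ↦ (x₀, x₁, x₂, -x₃, -x₄)`, the
rotation by `π` in the normal plane of the unknotted `S² = S⁴ ∩ (ℝ³ × {0})` — the covering
transformation of `Σ₂(S⁴, unknot) = S⁴` (Miyazawa, arXiv:2312.02041, proof of Prop. 3.14).
[cite: Miyazawa2023, proof of Prop. 3.14 (p. 24)] -/
def halfTurn (p : 𝕊 4) : 𝕊 4 :=
  ⟨halfTurnVec p, by rw [mem_sphere_zero_iff_norm, norm_halfTurnVec, norm_eq_of_mem_sphere p]⟩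

/-- The half-turn in coordinates. [folklore] -/
@[simp] theorem coe_halfTurn (p : 𝕊 4) : (halfTurn p : 𝔼 5) = halfTurnVec p := rfl

/-- The half-turn of `S⁴` is an involution. [folklore] -/
@[simp] theorem halfTurn_halfTurn (p : 𝕊 4) : halfTurn (halfTurn p) = p :=
  Subtype.ext (halfTurnVec_halfTurnVec _)

/-- The half-turn of `S⁴` is `C^∞`. [folklore] -/
theorem contMDiff_halfTurn : ContMDiff (𝓡 4) (𝓡 4) ∞ halfTurn :=
  (contDiff_halfTurnVec.contMDiff.comp contMDiff_coe_sphere).codRestrict_sphere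
    fun p ↦ (halfTurn p).2

/-- **The fixed points of the half-turn are exactly the unknotted 2-sphere** `{v = 0}`.
[cite: Miyazawa2023, proof of Prop. 3.14 (p. 24)] -/
theorem halfTurn_eq_self_iff (p : 𝕊 4) : halfTurn p = p ↔ tailTwo (p : 𝔼 5) = 0 := by
  rw [← Subtype.coe_inj, coe_halfTurn]
  constructor
  · intro h
    have h1 := congrArg tailTwo h
    rw [tailTwo_halfTurnVec, neg_eq_iff_add_eq_zero, ← two_smul ℝ, smul_eq_zero] at h1
    exact h1.resolve_left two_ne_zero
  · intro h
    rw [halfTurnVec, h, neg_zero, ← h, appendFive_headThree_tailTwo]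

/-! ## The fold map -/

/-- The fold map of `ℝ⁵ = ℝ³ × ℝ²` before normalisation: `F (y, v) = (y, v²)`. [folklore] -/
def foldVec (z : 𝔼 5) : 𝔼 5 := appendFive (headThree z) (normalSq (tailTwo z))

/-- Head of `F (y, v)`: `y`. [folklore] -/
@[simp] theorem headThree_foldVec (z : 𝔼 5) : headThree (foldVec z) = headThree z := by
  rw [foldVec, headThree_appendFive]

/-- Tail of `F (y, v)`: `v²`. [folklore] -/
@[simp] theorem tailTwo_foldVec (z : 𝔼 5) : tailTwo (foldVec z) = normalSq (tailTwo z) := by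
  rw [foldVec, tailTwo_appendFive]

/-- `‖F (y, v)‖² = ‖y‖² + ‖v‖⁴`. [folklore] -/
theorem norm_sq_foldVec (z : 𝔼 5) : ‖foldVec z‖ ^ 2 = ‖headThree z‖ ^ 2 + (‖tailTwo z‖ ^ 2) ^ 2 := by
  rw [foldVec, norm_sq_appendFive, norm_normalSq]

/-- `F` is even in `v`: `F (y, -v) = F (y, v)`. [folklore] -/
@[simp] theorem foldVec_halfTurnVec (z : 𝔼 5) : foldVec (halfTurnVec z) = foldVec z := by
  rw [foldVec, foldVec, headThree_halfTurnVec, tailTwo_halfTurnVec, normalSq_neg]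

/-- `F` is `C^∞` (polynomial). [folklore] -/
theorem contDiff_foldVec : ContDiff ℝ ∞ foldVec :=
  contDiff_appendFive.comp (contDiff_headThree.prodMk (contDiff_normalSq.comp contDiff_tailTwo))

/-- `F` does not vanish on the sphere (if `y = 0` then `‖v‖ = 1`). [folklore] -/
theorem foldVec_ne_zero (p : 𝕊 4) : foldVec (p : 𝔼 5) ≠ 0 := by
  intro h
  have h1 := norm_sq_foldVec (p : 𝔼 5)
  have h2 := norm_sq_eq_headThree_tailTwo (p : 𝔼 5)
  rw [h, norm_zero] at h1
  rw [norm_eq_of_mem_sphere p] at h2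
  nlinarith [sq_nonneg ‖headThree (p : 𝔼 5)‖, sq_nonneg ‖tailTwo (p : 𝔼 5)‖]

/-- `‖F p‖ > 0` on the sphere. [folklore] -/
theorem norm_foldVec_pos (p : 𝕊 4) : 0 < ‖foldVec (p : 𝔼 5)‖ :=
  norm_pos_iff.2 (foldVec_ne_zero p)

/-- **The fold map** `q : S⁴ → S⁴`, `(y, v) ↦ (y, v²)/‖(y, v²)‖`: the projection of the branched
double cover `Σ₂(S⁴, unknot) = S⁴ → S⁴`, i.e. the orbit map of the linear half-turn followed by
the identification `S⁴/ι ≅ S⁴` (Miyazawa, arXiv:2312.02041, proof of Prop. 3.14: the cover of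
`(ℝ⁴)⁺ ⊇ (ℝ²)⁺` with covering transformation `(x₁, x₂, -x₃, -x₄)`, here compactified inside
`ℝ³ × ℂ`). [cite: Miyazawa2023, proof of Prop. 3.14 (p. 24)] -/
def fold (p : 𝕊 4) : 𝕊 4 :=
  ⟨NormedSpace.normalize (foldVec p), by
    rw [mem_sphere_zero_iff_norm, NormedSpace.norm_normalize (foldVec_ne_zero p)]⟩

/-- The fold map in coordinates. [folklore] -/
@[simp] theorem coe_fold (p : 𝕊 4) : (fold p : 𝔼 5) = NormedSpace.normalize (foldVec p) := rfl

/-- The fold map in coordinates, as a scalar multiple. [folklore] -/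
theorem coe_fold_eq_smul (p : 𝕊 4) : (fold p : 𝔼 5) = ‖foldVec (p : 𝔼 5)‖⁻¹ • foldVec p := rfl

/-- Head of `q (y, v)`: `y / ‖F‖`. [folklore] -/
theorem headThree_fold (p : 𝕊 4) :
    headThree (fold p : 𝔼 5) = ‖foldVec (p : 𝔼 5)‖⁻¹ • headThree (p : 𝔼 5) := by
  rw [coe_fold_eq_smul, headThree_smul, headThree_foldVec]

/-- Tail of `q (y, v)`: `v² / ‖F‖`. [folklore] -/
theorem tailTwo_fold (p : 𝕊 4) :
    tailTwo (fold p : 𝔼 5) = ‖foldVec (p : 𝔼 5)‖⁻¹ • normalSq (tailTwo (p : 𝔼 5)) := by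
  rw [coe_fold_eq_smul, tailTwo_smul, tailTwo_foldVec]

/-- The fold map is `C^∞` (normalisation is smooth off the origin, `F ≠ 0` on the sphere).
[folklore] -/
theorem contMDiff_fold : ContMDiff (𝓡 4) (𝓡 4) ∞ fold := by
  have h1 : ContMDiff (𝓡 4) 𝓘(ℝ, 𝔼 5) ∞ fun p : 𝕊 4 ↦ foldVec (p : 𝔼 5) :=
    contDiff_foldVec.contMDiff.comp contMDiff_coe_sphere
  have h2 : ContMDiff (𝓡 4) 𝓘(ℝ, 𝔼 5) ∞ fun p : 𝕊 4 ↦ NormedSpace.normalize (foldVec (p : 𝔼 5)) :=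
    contDiffOn_normalize.contMDiffOn.comp_contMDiff h1 fun p ↦ foldVec_ne_zero p
  exact h2.codRestrict_sphere fun p ↦ (fold p).2

/-- **`q ∘ ι = q`**: the fold map is invariant under the half-turn. [folklore] -/
@[simp] theorem fold_halfTurn (p : 𝕊 4) : fold (halfTurn p) = fold p :=
  Subtype.ext (by rw [coe_fold, coe_fold, coe_halfTurn, foldVec_halfTurnVec])

/-- The tail of `q p` vanishes iff the tail of `p` does. [folklore] -/
theorem tailTwo_fold_eq_zero_iff (p : 𝕊 4) :
    tailTwo (fold p : 𝔼 5) = 0 ↔ tailTwo (p : 𝔼 5) = 0 := by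
  rw [tailTwo_fold, smul_eq_zero, normalSq_eq_zero_iff,
    or_iff_right (inv_ne_zero (norm_foldVec_pos p).ne')]

/-- The head of `q p` vanishes iff the head of `p` does. [folklore] -/
theorem headThree_fold_eq_zero_iff (p : 𝕊 4) :
    headThree (fold p : 𝔼 5) = 0 ↔ headThree (p : 𝔼 5) = 0 := by
  rw [headThree_fold, smul_eq_zero, or_iff_right (inv_ne_zero (norm_foldVec_pos p).ne')]

/-- **`q⁻¹(U) = U`**: `q p` lies on the unknotted 2-sphere iff `p` does. [folklore] -/
theorem fold_mem_range_unknotTwo_iff (p : 𝕊 4) :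
    fold p ∈ range unknotTwo ↔ tailTwo (p : 𝔼 5) = 0 := by
  rw [mem_range_unknotTwo_iff, tailTwo_fold_eq_zero_iff]

/-! ## The fibres of the fold map -/

/-- Two non-zero vectors with the same normalisation are positive multiples of each other.
[folklore] -/
theorem eq_smul_of_normalize_eq {F : Type*} [NormedAddCommGroup F] [NormedSpace ℝ F] {a b : F}
    (h : NormedSpace.normalize a = NormedSpace.normalize b) : a = (‖a‖ * ‖b‖⁻¹) • b :=
  calc a = ‖a‖ • NormedSpace.normalize a := (NormedSpace.norm_smul_normalize a).symm
    _ = ‖a‖ • NormedSpace.normalize b := by rw [h]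
    _ = (‖a‖ * ‖b‖⁻¹) • b := by rw [NormedSpace.normalize, smul_smul]

/-- **The fibres of the fold map are the orbits of the half-turn**: `q y = q x` implies `y = x` or
`y = ι x`. (`F y = r F x` with `r > 0`; on the unit sphere `r² ‖x_head‖² + r ‖x_tail‖² = 1 =
‖x_head‖² + ‖x_tail‖²` forces `r = 1`, then `y_tail² = x_tail²` gives `y_tail = ± x_tail`.)
[cite: Miyazawa2023, proof of Prop. 3.14 (p. 24)] -/
theorem eq_or_eq_halfTurn_of_fold_eq {x y : 𝕊 4} (h : fold y = fold x) :
    y = x ∨ y = halfTurn x := by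
  have h1 : NormedSpace.normalize (foldVec (y : 𝔼 5)) = NormedSpace.normalize (foldVec (x : 𝔼 5)) :=
    congrArg Subtype.val h
  set r : ℝ := ‖foldVec (y : 𝔼 5)‖ * ‖foldVec (x : 𝔼 5)‖⁻¹ with hr
  have hr0 : 0 < r := mul_pos (norm_foldVec_pos y) (inv_pos.2 (norm_foldVec_pos x))
  have h2 : foldVec (y : 𝔼 5) = r • foldVec (x : 𝔼 5) := eq_smul_of_normalize_eq h1
  -- components
  have hhead : headThree (y : 𝔼 5) = r • headThree (x : 𝔼 5) := by
    have := congrArg headThree h2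
    rwa [headThree_foldVec, headThree_smul, headThree_foldVec] at this
  have htail : normalSq (tailTwo (y : 𝔼 5)) = r • normalSq (tailTwo (x : 𝔼 5)) := by
    have := congrArg tailTwo h2
    rwa [tailTwo_foldVec, tailTwo_smul, tailTwo_foldVec] at this
  -- norms: `a' = r² a`, `b' = r b`, `a + b = 1 = a' + b'`
  set a : ℝ := ‖headThree (x : 𝔼 5)‖ ^ 2 with ha
  set b : ℝ := ‖tailTwo (x : 𝔼 5)‖ ^ 2 with hb
  have hab : a + b = 1 := by
    rw [ha, hb, ← norm_sq_eq_headThree_tailTwo, norm_eq_of_mem_sphere x, one_pow]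
  have ha' : ‖headThree (y : 𝔼 5)‖ ^ 2 = r ^ 2 * a := by
    rw [hhead, norm_smul, Real.norm_of_nonneg hr0.le, mul_pow]
  have hb' : ‖tailTwo (y : 𝔼 5)‖ ^ 2 = r * b := by
    rw [hb, ← norm_normalSq, ← norm_normalSq, htail, norm_smul, Real.norm_of_nonneg hr0.le]
  have hab' : r ^ 2 * a + r * b = 1 := by
    rw [← ha', ← hb', ← norm_sq_eq_headThree_tailTwo, norm_eq_of_mem_sphere y, one_pow]
  have hr1 : r = 1 := by
    have ha0 : 0 ≤ a := sq_nonneg _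
    have hb0 : 0 ≤ b := sq_nonneg _
    have hfac : (r - 1) * (a * (r + 1) + b) = 0 := by nlinarith
    have hpos : 0 < a * (r + 1) + b := by nlinarith
    have := (mul_eq_zero.1 hfac).resolve_right hpos.ne'
    linarith
  rw [hr1, one_smul] at hhead htail
  rcases normalSq_eq_normalSq_iff.1 htail with ht | ht
  · left
    apply Subtype.ext
    rw [← appendFive_headThree_tailTwo (y : 𝔼 5), hhead, ht, appendFive_headThree_tailTwo]
  · right
    apply Subtype.ext
    rw [← appendFive_headThree_tailTwo (y : 𝔼 5), hhead, ht, coe_halfTurn, halfTurnVec]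

/-! ## The fold map is onto -/

/-- The positive root `c = 2 / (b + √(b² + 4a))` of `a c² + b c = 1` (`a, b ≥ 0`, not both zero).
[folklore] -/
def posRoot (a b : ℝ) : ℝ := 2 / (b + Real.sqrt (b ^ 2 + 4 * a))

/-- `c > 0`. [folklore] -/
theorem posRoot_pos {a b : ℝ} (ha : 0 ≤ a) (hb : 0 ≤ b) (h : a ≠ 0 ∨ b ≠ 0) : 0 < posRoot a b := by
  unfold posRoot
  have hR : 0 ≤ Real.sqrt (b ^ 2 + 4 * a) := Real.sqrt_nonneg _
  have hpos : 0 < b + Real.sqrt (b ^ 2 + 4 * a) := by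
    rcases h with h | h
    · have : 0 < Real.sqrt (b ^ 2 + 4 * a) := Real.sqrt_pos.2 (by positivity)
      linarith
    · have : 0 < b := lt_of_le_of_ne hb (Ne.symm h)
      linarith
  positivity

/-- `a c² + b c = 1`. [folklore] -/
theorem posRoot_spec {a b : ℝ} (ha : 0 ≤ a) (hb : 0 ≤ b) (h : a ≠ 0 ∨ b ≠ 0) :
    a * posRoot a b ^ 2 + b * posRoot a b = 1 := by
  set R := Real.sqrt (b ^ 2 + 4 * a) with hRdef
  have hR0 : 0 ≤ R := Real.sqrt_nonneg _
  have hR2 : R ^ 2 = b ^ 2 + 4 * a := Real.sq_sqrt (by positivity)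
  have hpos : 0 < b + R := by
    rcases h with h | h
    · have : 0 < R := Real.sqrt_pos.2 (by positivity)
      linarith
    · have : 0 < b := lt_of_le_of_ne hb (Ne.symm h)
      linarith
  have hc : posRoot a b = 2 / (b + R) := rfl
  rw [hc, div_pow]
  field_simp
  nlinarith [hR2]

/-- **The fold map is onto**: `s = (h, t)` is the fold of `(c h, w)` where `c` is the positive
root of `‖h‖² c² + ‖t‖ c = 1` and `w² = c t`. [cite: Miyazawa2023, proof of Prop. 3.14 (p. 24)] -/
theorem fold_surjective : Surjective fold := by
  intro s
  set a : ℝ := ‖headThree (s : 𝔼 5)‖ ^ 2 with ha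
  set b : ℝ := ‖tailTwo (s : 𝔼 5)‖ with hb
  have ha0 : 0 ≤ a := sq_nonneg _
  have hb0 : 0 ≤ b := norm_nonneg _
  have hab : a ≠ 0 ∨ b ≠ 0 := by
    rcases headThree_ne_zero_or_tailTwo_ne_zero s with h | h
    · exact Or.inl (pow_ne_zero 2 (norm_ne_zero_iff.2 h))
    · exact Or.inr (norm_ne_zero_iff.2 h)
  set c := posRoot a b with hc
  have hc0 : 0 < c := posRoot_pos ha0 hb0 hab
  have hspec : a * c ^ 2 + b * c = 1 := posRoot_spec ha0 hb0 hab
  obtain ⟨w, hw⟩ := normalSq_surjective (c • tailTwo (s : 𝔼 5))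
  set z : 𝔼 5 := appendFive (c • headThree (s : 𝔼 5)) w with hz
  have hz1 : ‖z‖ = 1 := by
    have h1 : ‖z‖ ^ 2 = 1 := by
      rw [hz, norm_sq_appendFive, norm_smul, Real.norm_of_nonneg hc0.le, mul_pow, ← norm_normalSq,
        hw, norm_smul, Real.norm_of_nonneg hc0.le, ← ha, ← hb]
      linear_combination hspec
    nlinarith [norm_nonneg z]
  refine ⟨⟨z, by rw [mem_sphere_zero_iff_norm, hz1]⟩, Subtype.ext ?_⟩
  rw [coe_fold]
  change NormedSpace.normalize (foldVec z) = (s : 𝔼 5)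
  have hF : foldVec z = c • (s : 𝔼 5) := by
    rw [foldVec, hz, headThree_appendFive, tailTwo_appendFive, hw, ← smul_appendFive,
      appendFive_headThree_tailTwo]
  rw [hF, NormedSpace.normalize_smul_of_pos hc0,
    NormedSpace.normalize_eq_self_of_norm_eq_one (norm_eq_of_mem_sphere s)]

/-! ## The radial reparametrisation of the normal plane -/

/-- `R(s) = √(s² + 4)`. [folklore] -/
def rootFn (s : ℝ) : ℝ := Real.sqrt (s ^ 2 + 4)

/-- `R(s)² = s² + 4`. [folklore] -/
theorem rootFn_sq (s : ℝ) : rootFn s ^ 2 = s ^ 2 + 4 := Real.sq_sqrt (by positivity)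

/-- `R(s) > |s|`, so `s + R(s) > 0`. [folklore] -/
theorem add_rootFn_pos (s : ℝ) : 0 < s + rootFn s := by
  have h1 : |s| < rootFn s := (Real.lt_sqrt (abs_nonneg s)).2 (by rw [sq_abs]; linarith)
  have h2 : -s ≤ |s| := neg_le_abs s
  linarith

/-- `R` is `C^∞` (square root of a positive polynomial). [folklore] -/
theorem contDiff_rootFn : ContDiff ℝ ∞ rootFn :=
  ((contDiff_id.pow 2).add contDiff_const).sqrt fun s ↦ by positivity

/-- **The radial factor** `c(s) = √((s + √(s² + 4))/2)`, the positive solution of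
`c⁴ = 1 + s c²`: reparametrising the normal plane by `w ↦ c(‖w‖²) w` makes the fold of the tube
EXACTLY the tube of the square (`fold_modelMap`). [folklore] -/
def radial (s : ℝ) : ℝ := Real.sqrt ((s + rootFn s) / 2)

/-- `c(s) > 0`. [folklore] -/
theorem radial_pos (s : ℝ) : 0 < radial s :=
  Real.sqrt_pos.2 (by have := add_rootFn_pos s; positivity)

/-- `c(s)² = (s + R(s))/2`. [folklore] -/
theorem radial_sq (s : ℝ) : radial s ^ 2 = (s + rootFn s) / 2 :=
  Real.sq_sqrt (by have := add_rootFn_pos s; positivity)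

/-- **`c⁴ = 1 + s c²`.** [folklore] -/
theorem radial_pow_four (s : ℝ) : radial s ^ 4 = 1 + s * radial s ^ 2 := by
  have h2 := radial_sq s
  calc radial s ^ 4 = (radial s ^ 2) ^ 2 := by ring
    _ = ((s + rootFn s) / 2) ^ 2 := by rw [h2]
    _ = 1 + s * ((s + rootFn s) / 2) := by linear_combination (1 / 4 : ℝ) * rootFn_sq s
    _ = 1 + s * radial s ^ 2 := by rw [h2]

/-- `c` is `C^∞`. [folklore] -/
theorem contDiff_radial : ContDiff ℝ ∞ radial :=
  ((contDiff_id.add contDiff_rootFn).div_const 2).sqrt fun s ↦ by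
    have := add_rootFn_pos s; positivity

/-- The radial reparametrisation `w ↦ c(‖w‖²) w` of the normal plane. [folklore] -/
def radialMap (w : 𝔼 2) : 𝔼 2 := radial (‖w‖ ^ 2) • w

/-- Its inverse `u ↦ (1 + ‖u‖²)^{-1/4} u`. [folklore] -/
def radialInv (u : 𝔼 2) : 𝔼 2 := (Real.sqrt (Real.sqrt (1 + ‖u‖ ^ 2)))⁻¹ • u

/-- `radialMap` is `C^∞`. [folklore] -/
theorem contDiff_radialMap : ContDiff ℝ ∞ radialMap :=
  (contDiff_radial.comp (contDiff_norm_sq ℝ)).smul contDiff_id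

/-- The fourth root `(1 + ‖u‖²)^{1/4}` is positive. [folklore] -/
theorem fourthRoot_pos (u : 𝔼 2) : 0 < Real.sqrt (Real.sqrt (1 + ‖u‖ ^ 2)) :=
  Real.sqrt_pos.2 (Real.sqrt_pos.2 (by positivity))

/-- `radialInv` is `C^∞`. [folklore] -/
theorem contDiff_radialInv : ContDiff ℝ ∞ radialInv := by
  have h1 : ContDiff ℝ ∞ fun u : 𝔼 2 ↦ Real.sqrt (1 + ‖u‖ ^ 2) :=
    (contDiff_const.add (contDiff_norm_sq ℝ)).sqrt fun u ↦ by positivity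
  have h2 : ContDiff ℝ ∞ fun u : 𝔼 2 ↦ Real.sqrt (Real.sqrt (1 + ‖u‖ ^ 2)) :=
    h1.sqrt fun u ↦ (Real.sqrt_pos.2 (by positivity)).ne'
  exact (h2.inv fun u ↦ (fourthRoot_pos u).ne').smul contDiff_id

/-- `‖c w‖² = c² ‖w‖²` for `c ≥ 0`. [folklore] -/
theorem norm_sq_smul_of_nonneg {c : ℝ} (hc : 0 ≤ c) (w : 𝔼 2) : ‖c • w‖ ^ 2 = c ^ 2 * ‖w‖ ^ 2 := by
  rw [norm_smul, Real.norm_of_nonneg hc, mul_pow]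

/-- `1 + ‖c(‖w‖²) w‖² = c(‖w‖²)⁴`. [folklore] -/
theorem one_add_norm_sq_radialMap (w : 𝔼 2) :
    1 + ‖radialMap w‖ ^ 2 = radial (‖w‖ ^ 2) ^ 4 := by
  rw [radialMap, norm_sq_smul_of_nonneg (radial_pos _).le, radial_pow_four]
  ring

/-- `radialInv ∘ radialMap = id`. [folklore] -/
theorem radialInv_radialMap (w : 𝔼 2) : radialInv (radialMap w) = w := by
  set c := radial (‖w‖ ^ 2) with hc
  have hc0 : 0 < c := radial_pos _
  have h1 : Real.sqrt (Real.sqrt (1 + ‖radialMap w‖ ^ 2)) = c := by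
    rw [one_add_norm_sq_radialMap, ← hc, show c ^ 4 = (c ^ 2) ^ 2 by ring,
      Real.sqrt_sq (sq_nonneg c), Real.sqrt_sq hc0.le]
  rw [radialInv, h1, radialMap, ← hc, smul_smul, inv_mul_cancel₀ hc0.ne', one_smul]

/-- `radialMap ∘ radialInv = id`. [folklore] -/
theorem radialMap_radialInv (u : 𝔼 2) : radialMap (radialInv u) = u := by
  set t : ℝ := ‖u‖ ^ 2 with ht
  set d : ℝ := Real.sqrt (Real.sqrt (1 + t)) with hd
  have ht0 : 0 ≤ t := sq_nonneg _
  have hd0 : 0 < d := fourthRoot_pos u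
  have hd2 : d ^ 2 = Real.sqrt (1 + t) := Real.sq_sqrt (Real.sqrt_nonneg _)
  have hd4 : d ^ 4 = 1 + t := by
    rw [show d ^ 4 = (d ^ 2) ^ 2 by ring, hd2, Real.sq_sqrt (by positivity)]
  -- `s = ‖d⁻¹ u‖² = t / d²`
  have hs : ‖radialInv u‖ ^ 2 = t / d ^ 2 := by
    rw [radialInv, norm_sq_smul_of_nonneg (inv_nonneg.2 (fourthRoot_pos u).le), inv_pow, ← ht,
      ← hd, inv_mul_eq_div]
  set s : ℝ := ‖radialInv u‖ ^ 2 with hs'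
  -- `R(s) = (t + 2)/d²` and `c(s) = d`
  have hR : rootFn s = (t + 2) / d ^ 2 := by
    have h1 : s ^ 2 + 4 = ((t + 2) / d ^ 2) ^ 2 := by
      rw [hs]
      field_simp
      nlinarith [hd4]
    rw [rootFn, h1, Real.sqrt_sq (by positivity)]
  have hc2 : radial s ^ 2 = d ^ 2 := by
    rw [radial_sq, hR, hs]
    field_simp
    nlinarith [hd4]
  have hc : radial s = d := by
    have := radial_pos s
    nlinarith [hc2]
  rw [radialMap, ← hs', hc, radialInv, ← ht, ← hd, smul_smul, mul_inv_cancel₀ hd0.ne', one_smul]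

/-- The radial reparametrisation is onto. [folklore] -/
theorem radialMap_surjective : Surjective radialMap :=
  fun u ↦ ⟨radialInv u, radialMap_radialInv u⟩

/-- `radialMap (-w) = - radialMap w`. [folklore] -/
theorem radialMap_neg (w : 𝔼 2) : radialMap (-w) = -radialMap w := by
  rw [radialMap, radialMap, norm_neg, smul_neg]

/-! ## The model embedding `j (p, w) = ν (p, c(‖w‖²) w)` -/

/-- **The model embedding** `j : S² × ℝ² → S⁴`, `j (p, w) = (p, c(‖w‖²) w)/‖(p, c(‖w‖²) w)‖`:
the tube `unknotTube` precomposed with the radial reparametrisation of the normal plane.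
[folklore] -/
def modelMap (q : (𝕊 2) × 𝔼 2) : 𝕊 4 := tube (q.1, radialMap q.2)

/-- Its inverse on `{y ≠ 0}`. [folklore] -/
def modelInv (p : 𝕊 4) : (𝕊 2) × 𝔼 2 := ((tubeInv p).1, radialInv (tubeInv p).2)

/-- `modelInv ∘ modelMap = id`. [folklore] -/
theorem modelInv_modelMap (q : (𝕊 2) × 𝔼 2) : modelInv (modelMap q) = q := by
  obtain ⟨x, w⟩ := q
  simp only [modelInv, modelMap, tubeInv_tube, radialInv_radialMap]

/-- `modelMap ∘ modelInv = id` on `{y ≠ 0}`. [folklore] -/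
theorem modelMap_modelInv {p : 𝕊 4} (hp : headThree (p : 𝔼 5) ≠ 0) : modelMap (modelInv p) = p := by
  rw [modelMap, modelInv, radialMap_radialInv]
  exact tube_tubeInv hp

/-- The model embedding is `C^∞`. [folklore] -/
theorem contMDiff_modelMap : ContMDiff ((𝓡 2).prod 𝓘(ℝ, 𝔼 2)) (𝓡 4) ∞ modelMap :=
  contMDiff_tube.comp (contMDiff_fst.prodMk (contDiff_radialMap.contMDiff.comp contMDiff_snd))

/-- The inverse of the model embedding is `C^∞` on `{y ≠ 0}`. [folklore] -/
theorem contMDiffOn_modelInv :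
    ContMDiffOn (𝓡 4) ((𝓡 2).prod 𝓘(ℝ, 𝔼 2)) ∞ modelInv {p : 𝕊 4 | headThree (p : 𝔼 5) ≠ 0} :=
  (contMDiff_fst.prodMk (contDiff_radialInv.contMDiff.comp contMDiff_snd)).comp_contMDiffOn
    contMDiffOn_tubeInv

/-- The model embedding as an open partial homeomorphism `S² × ℝ² ⇀ S⁴` with source `univ` and
target `{y ≠ 0}`. [folklore] -/
def modelHomeomorph : OpenPartialHomeomorph ((𝕊 2) × 𝔼 2) (𝕊 4) where
  toFun := modelMap
  invFun := modelInv
  source := univ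
  target := {p : 𝕊 4 | headThree (p : 𝔼 5) ≠ 0}
  map_source' _ _ := headThree_tubeVec_ne_zero _
  map_target' _ _ := mem_univ _
  left_inv' q _ := modelInv_modelMap q
  right_inv' _ hp := modelMap_modelInv hp
  open_source := isOpen_univ
  open_target := isOpen_headThree_ne_zero
  continuousOn_toFun := contMDiff_modelMap.continuous.continuousOn
  continuousOn_invFun := contMDiffOn_modelInv.continuousOn

/-- `modelHomeomorph` is `modelMap` as a function. [folklore] -/
@[simp] theorem coe_modelHomeomorph : ⇑modelHomeomorph = modelMap := rfl

/-- The source of `modelHomeomorph` is everything. [folklore] -/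
theorem modelHomeomorph_source : modelHomeomorph.source = univ := rfl

/-- The target of `modelHomeomorph` is `{y ≠ 0}`. [folklore] -/
theorem modelHomeomorph_target :
    modelHomeomorph.target = {p : 𝕊 4 | headThree (p : 𝔼 5) ≠ 0} := rfl

/-- **The model embedding is a smooth embedding** `S² × ℝ² ↪ S⁴` (a globally defined partial
diffeomorphism). [folklore] -/
theorem isSmoothEmbedding_modelMap :
    Manifold.IsSmoothEmbedding ((𝓡 2).prod 𝓘(ℝ, 𝔼 2)) (𝓡 4) ∞ modelMap :=
  isSmoothEmbedding_of_openPartialHomeomorph modelHomeomorph rfl contMDiff_modelMap.contMDiffOn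
    contMDiffOn_modelInv (ContinuousLinearEquiv.ofFinrankEq (by simp))

/-- The image of the model embedding is `{y ≠ 0}`, the image of the tube. [folklore] -/
theorem range_modelMap : range modelMap = {p : 𝕊 4 | headThree (p : 𝔼 5) ≠ 0} := by
  rw [← image_univ, ← modelHomeomorph_source, ← coe_modelHomeomorph,
    modelHomeomorph.image_source_eq_target, modelHomeomorph_target]

/-- The image of the model embedding is open. [folklore] -/
theorem isOpen_range_modelMap : IsOpen (range modelMap) := by
  rw [range_modelMap]; exact isOpen_headThree_ne_zero

/-- **The model equation for the projection**: `q (j (p, w)) = ν (p, w²)` — the fold of the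
reparametrised tube is exactly the tube of the square. (With `A = (p, c w)`, `‖A‖ = c²` by
`c⁴ = 1 + c² ‖w‖²`, and `F(A/‖A‖) = (p, c² w²/‖A‖)/‖A‖ = (p, w²)/‖A‖`.) [folklore] -/
theorem fold_modelMap (x : 𝕊 2) (w : 𝔼 2) : fold (modelMap (x, w)) = tube (x, normalSq w) := by
  set c := radial (‖w‖ ^ 2) with hc
  have hc0 : 0 < c := radial_pos _
  set A : 𝔼 5 := appendFive (x : 𝔼 3) (c • w) with hA
  have hA0 : 0 < ‖A‖ := norm_appendFive_pos x _
  have hA2 : ‖A‖ ^ 2 = c ^ 4 := by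
    rw [hA, norm_sq_appendFive, norm_eq_of_mem_sphere x, one_pow, ← radialMap.eq_1,
      one_add_norm_sq_radialMap]
  have hAc : ‖A‖ = c ^ 2 := by nlinarith [sq_nonneg c]
  set r : ℝ := ‖A‖⁻¹ with hr
  have hr0 : 0 < r := inv_pos.2 hA0
  have hrc : (r * c) ^ 2 = r := by
    rw [hr, hAc, mul_pow, inv_pow]
    field_simp
  apply Subtype.ext
  rw [coe_fold, modelMap, coe_tube, coe_tube]
  change NormedSpace.normalize (foldVec (tubeVec (x, radialMap w))) = tubeVec (x, normalSq w)
  have h1 : tubeVec (x, radialMap w) = r • A := rfl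
  have h2 : foldVec (r • A) = r • appendFive (x : 𝔼 3) (normalSq w) := by
    rw [foldVec, headThree_smul, tailTwo_smul, hA, headThree_appendFive, tailTwo_appendFive,
      smul_smul, normalSq_smul, hrc, smul_appendFive]
  rw [h1, h2, NormedSpace.normalize_smul_of_pos hr0]
  rfl

/-- The half-turn commutes with normalisation (it is a linear isometry). [folklore] -/
theorem halfTurnVec_normalize (A : 𝔼 5) :
    halfTurnVec (NormedSpace.normalize A) = NormedSpace.normalize (halfTurnVec A) := by
  rw [NormedSpace.normalize, halfTurnVec_smul, NormedSpace.normalize, norm_halfTurnVec]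

/-- **The model equation for the deck involution**: `ι (j (p, w)) = j (p, -w)`. [folklore] -/
theorem halfTurn_modelMap (x : 𝕊 2) (w : 𝔼 2) : halfTurn (modelMap (x, w)) = modelMap (x, -w) := by
  apply Subtype.ext
  rw [coe_halfTurn, modelMap, modelMap, coe_tube, coe_tube, radialMap_neg]
  change halfTurnVec (NormedSpace.normalize (appendFive (x : 𝔼 3) (radialMap w))) =
    NormedSpace.normalize (appendFive (x : 𝔼 3) (-radialMap w))
  rw [halfTurnVec_normalize, halfTurnVec, headThree_appendFive, tailTwo_appendFive]

/-- **The model piece is the preimage of the tube**: `j (S² × ℝ²) = q⁻¹(ν(S² × ℝ²)) = {y ≠ 0}`.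
[folklore] -/
theorem range_modelMap_eq_preimage : range modelMap = fold ⁻¹' range tube := by
  rw [range_modelMap, range_tube]
  ext p
  simp only [mem_setOf_eq, mem_preimage, ne_eq, headThree_fold_eq_zero_iff]

/-! ## The differential of the fold map off the unknot -/

/-- Coordinate `0` of `F`. [folklore] -/
theorem foldVec_apply_zero (z : 𝔼 5) : foldVec z 0 = z 0 := rfl

/-- Coordinate `1` of `F`. [folklore] -/
theorem foldVec_apply_one (z : 𝔼 5) : foldVec z 1 = z 1 := rfl

/-- Coordinate `2` of `F`. [folklore] -/
theorem foldVec_apply_two (z : 𝔼 5) : foldVec z 2 = z 2 := rfl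

/-- Coordinate `3` of `F`: `z₃² - z₄²`. [folklore] -/
theorem foldVec_apply_three (z : 𝔼 5) : foldVec z 3 = z 3 ^ 2 - z 4 ^ 2 := rfl

/-- Coordinate `4` of `F`: `2 z₃ z₄`. [folklore] -/
theorem foldVec_apply_four (z : 𝔼 5) : foldVec z 4 = 2 * z 3 * z 4 := rfl

/-- `F` has a derivative everywhere. [folklore] -/
theorem hasFDerivAt_foldVec (z : 𝔼 5) : HasFDerivAt foldVec (fderiv ℝ foldVec z) z :=
  ((contDiff_foldVec.differentiable (by simp)) z).hasFDerivAt

/-- Coordinates of a derivative in `ℝ⁵`. [folklore] -/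
theorem hasFDerivAt_coord {f : 𝔼 5 → 𝔼 5} {D : 𝔼 5 →L[ℝ] 𝔼 5} {z : 𝔼 5} (h : HasFDerivAt f D z)
    (i : Fin 5) : HasFDerivAt (fun x ↦ f x i) (PiLp.proj (𝕜 := ℝ) 2 (fun _ : Fin 5 ↦ ℝ) i ∘L D) z :=
  hasFDerivWithinAt_univ.1 (hasFDerivWithinAt_euclidean.1 (h.hasFDerivWithinAt (s := univ)) i)

/-- **The differential of `F (y, v) = (y, v²)`**: `dF_z (W) = (W_head, 2 z_tail · W_tail)`
(complex multiplication in the tail), coordinatewise. [folklore] -/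
theorem fderiv_foldVec_apply (z W : 𝔼 5) :
    fderiv ℝ foldVec z W 0 = W 0 ∧ fderiv ℝ foldVec z W 1 = W 1 ∧ fderiv ℝ foldVec z W 2 = W 2 ∧
      fderiv ℝ foldVec z W 3 = 2 * (z 3 * W 3 - z 4 * W 4) ∧
      fderiv ℝ foldVec z W 4 = 2 * (z 3 * W 4 + z 4 * W 3) := by
  set D := fderiv ℝ foldVec z with hD
  have h := hasFDerivAt_foldVec z
  have hp : ∀ i : Fin 5, HasFDerivAt (fun x : 𝔼 5 ↦ x i) (PiLp.proj (𝕜 := ℝ) 2 (fun _ : Fin 5 ↦ ℝ) i) z :=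
    fun i ↦ PiLp.hasFDerivAt_apply 2 z i
  have key : ∀ (i : Fin 5) (L : 𝔼 5 →L[ℝ] ℝ), HasFDerivAt (fun x ↦ foldVec x i) L z → D W i = L W := by
    intro i L hL
    have hu : PiLp.proj (𝕜 := ℝ) 2 (fun _ : Fin 5 ↦ ℝ) i ∘L D = L := (hasFDerivAt_coord h i).unique hL
    have := congrArg (fun T : 𝔼 5 →L[ℝ] ℝ ↦ T W) hu
    simpa using this
  refine ⟨key 0 _ (hp 0), key 1 _ (hp 1), key 2 _ (hp 2), ?_, ?_⟩
  · have h3 : HasFDerivAt (fun x : 𝔼 5 ↦ foldVec x 3)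
        ((2 • z 3 ^ (2 - 1)) • PiLp.proj (𝕜 := ℝ) 2 (fun _ : Fin 5 ↦ ℝ) 3 -
          (2 • z 4 ^ (2 - 1)) • PiLp.proj (𝕜 := ℝ) 2 (fun _ : Fin 5 ↦ ℝ) 4) z :=
      ((hp 3).pow 2).sub ((hp 4).pow 2)
    rw [key 3 _ h3]
    simp
    ring
  · have h4 : HasFDerivAt (fun x : 𝔼 5 ↦ foldVec x 4)
        ((2 * z 3) • PiLp.proj (𝕜 := ℝ) 2 (fun _ : Fin 5 ↦ ℝ) 4 +
          z 4 • ((2 : ℝ) • PiLp.proj (𝕜 := ℝ) 2 (fun _ : Fin 5 ↦ ℝ) 3)) z :=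
      ((hp 3).const_mul 2).mul (hp 4)
    rw [key 4 _ h4]
    simp
    ring

/-- **Product rule**: if the differential of `F/‖F‖` kills `W`, then `dF(W)` is a multiple of
`F` (from `F = ‖F‖ • (F/‖F‖)`). [folklore] -/
theorem fderiv_foldVec_eq_smul (x : 𝕊 4) {W : 𝔼 5}
    (hW : fderiv ℝ (fun z ↦ NormedSpace.normalize (foldVec z)) x W = 0) :
    fderiv ℝ foldVec x W =
      (fderiv ℝ (fun z ↦ ‖foldVec z‖) x W * ‖foldVec (x : 𝔼 5)‖⁻¹) • foldVec (x : 𝔼 5) := by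
  set G := fun z : 𝔼 5 ↦ NormedSpace.normalize (foldVec z) with hGdef
  set nrm := fun z : 𝔼 5 ↦ ‖foldVec z‖ with hnrm
  have hx0 := foldVec_ne_zero x
  have hG : HasFDerivAt G (fderiv ℝ G x) x :=
    (((contDiffAt_normalize hx0).comp _ contDiff_foldVec.contDiffAt).differentiableAt
      (by simp)).hasFDerivAt
  have hn : HasFDerivAt nrm (fderiv ℝ nrm x) x :=
    ((contDiff_foldVec.contDiffAt.norm ℝ hx0).differentiableAt (by simp)).hasFDerivAt
  have hprod := hn.smul hG
  have heq : nrm • G = foldVec := funext fun z ↦ NormedSpace.norm_smul_normalize (foldVec z)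
  rw [heq] at hprod
  rw [(hasFDerivAt_foldVec x).unique hprod]
  change nrm x • fderiv ℝ G x W + fderiv ℝ nrm x W • G x = _
  rw [hW, smul_zero, zero_add, mul_smul]
  rfl

/-- The real inner product on `ℝ⁵` in coordinates. [folklore] -/
theorem inner_five (V W : 𝔼 5) :
    ⟪V, W⟫_ℝ = V 0 * W 0 + V 1 * W 1 + V 2 * W 2 + V 3 * W 3 + V 4 * W 4 := by
  simp [PiLp.inner_apply, Fin.sum_univ_five, mul_comm]

/-- `‖V‖² = Σ Vᵢ²` on `ℝ⁵`, written out. [folklore] -/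
theorem norm_sq_five (V : 𝔼 5) :
    ‖V‖ ^ 2 = V 0 ^ 2 + V 1 ^ 2 + V 2 ^ 2 + V 3 ^ 2 + V 4 ^ 2 := by
  rw [EuclideanSpace.real_norm_sq_eq, Fin.sum_univ_five]

/-- **The differential of the fold map is injective off the unknot.** At `x = (h, t) ∈ S⁴`
with `t ≠ 0`: if `W ⟂ x` and `d(F/‖F‖)_x (W) = 0`, then `dF(W) = μ F(x)` gives
`W = (μ h, μ t / 2)`, and `⟪x, W⟫ = μ (‖h‖² + ‖t‖²/2) = 0` forces `μ = 0`, `W = 0`.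
[folklore] -/
theorem eq_zero_of_fderiv_normalize_foldVec {x : 𝕊 4} (hx : tailTwo (x : 𝔼 5) ≠ 0) {W : 𝔼 5}
    (hW : fderiv ℝ (fun z ↦ NormedSpace.normalize (foldVec z)) x W = 0)
    (horth : ⟪(x : 𝔼 5), W⟫_ℝ = 0) : W = 0 := by
  obtain ⟨h0, h1, h2, h3, h4⟩ := fderiv_foldVec_apply (x : 𝔼 5) W
  have hs := fderiv_foldVec_eq_smul x hW
  generalize fderiv ℝ (fun z ↦ ‖foldVec z‖) x W * ‖foldVec (x : 𝔼 5)‖⁻¹ = μ at hs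
  -- the five coordinate equations `dF(W)_i = μ F(x)_i`
  have e0 : W 0 = μ * (x : 𝔼 5) 0 := by
    have := congrArg (fun v : 𝔼 5 ↦ v 0) hs; simpa [h0, foldVec_apply_zero] using this
  have e1 : W 1 = μ * (x : 𝔼 5) 1 := by
    have := congrArg (fun v : 𝔼 5 ↦ v 1) hs; simpa [h1, foldVec_apply_one] using this
  have e2 : W 2 = μ * (x : 𝔼 5) 2 := by
    have := congrArg (fun v : 𝔼 5 ↦ v 2) hs; simpa [h2, foldVec_apply_two] using this
  have e3 : 2 * ((x : 𝔼 5) 3 * W 3 - (x : 𝔼 5) 4 * W 4) = μ * ((x : 𝔼 5) 3 ^ 2 - (x : 𝔼 5) 4 ^ 2) := by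
    have := congrArg (fun v : 𝔼 5 ↦ v 3) hs; simpa [h3, foldVec_apply_three] using this
  have e4 : 2 * ((x : 𝔼 5) 3 * W 4 + (x : 𝔼 5) 4 * W 3) = μ * (2 * (x : 𝔼 5) 3 * (x : 𝔼 5) 4) := by
    have := congrArg (fun v : 𝔼 5 ↦ v 4) hs; simpa [h4, foldVec_apply_four] using this
  -- the derivative terms are no longer needed (and are expensive for `linarith` to inspect)
  clear h0 h1 h2 h3 h4 hs hW
  -- `t ≠ 0`: `x₃² + x₄² > 0`
  have ht : 0 < (x : 𝔼 5) 3 ^ 2 + (x : 𝔼 5) 4 ^ 2 := by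
    have h := EuclideanSpace.real_norm_sq_eq (tailTwo (x : 𝔼 5))
    rw [Fin.sum_univ_two, tailTwo_apply_zero, tailTwo_apply_one] at h
    have hn : 0 < ‖tailTwo (x : 𝔼 5)‖ := norm_pos_iff.2 hx
    nlinarith
  -- solve the tail equations: `W₃ = μ x₃ / 2`, `W₄ = μ x₄ / 2`
  have e3' : W 3 = μ * (x : 𝔼 5) 3 / 2 := by
    have key : 2 * W 3 * ((x : 𝔼 5) 3 ^ 2 + (x : 𝔼 5) 4 ^ 2) =
        μ * (x : 𝔼 5) 3 * ((x : 𝔼 5) 3 ^ 2 + (x : 𝔼 5) 4 ^ 2) := by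
      linear_combination (x : 𝔼 5) 3 * e3 + (x : 𝔼 5) 4 * e4
    field_simp
    nlinarith [mul_right_cancel₀ ht.ne' key]
  have e4' : W 4 = μ * (x : 𝔼 5) 4 / 2 := by
    have key : 2 * W 4 * ((x : 𝔼 5) 3 ^ 2 + (x : 𝔼 5) 4 ^ 2) =
        μ * (x : 𝔼 5) 4 * ((x : 𝔼 5) 3 ^ 2 + (x : 𝔼 5) 4 ^ 2) := by
      linear_combination (x : 𝔼 5) 3 * e4 - (x : 𝔼 5) 4 * e3
    field_simp
    nlinarith [mul_right_cancel₀ ht.ne' key]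
  -- orthogonality: `μ (‖h‖² + ‖t‖²/2) = 0`, and `‖x‖ = 1`
  have hsphere : (x : 𝔼 5) 0 ^ 2 + (x : 𝔼 5) 1 ^ 2 + (x : 𝔼 5) 2 ^ 2 + (x : 𝔼 5) 3 ^ 2 +
      (x : 𝔼 5) 4 ^ 2 = 1 := by
    rw [← norm_sq_five, norm_eq_of_mem_sphere x, one_pow]
  rw [inner_five, e0, e1, e2, e3', e4'] at horth
  have hq : μ * (1 - ((x : 𝔼 5) 3 ^ 2 + (x : 𝔼 5) 4 ^ 2) / 2) = 0 := by
    linear_combination horth - μ * hsphere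
  have hs1 : (x : 𝔼 5) 3 ^ 2 + (x : 𝔼 5) 4 ^ 2 ≤ 1 := by
    nlinarith [hsphere, sq_nonneg ((x : 𝔼 5) 0), sq_nonneg ((x : 𝔼 5) 1), sq_nonneg ((x : 𝔼 5) 2)]
  have hne : 1 - ((x : 𝔼 5) 3 ^ 2 + (x : 𝔼 5) 4 ^ 2) / 2 ≠ 0 := by
    intro h0
    linarith
  have hμ0 : μ = 0 := (mul_eq_zero.1 hq).resolve_right hne
  ext i
  fin_cases i
  · simpa [hμ0] using e0
  · simpa [hμ0] using e1
  · simpa [hμ0] using e2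
  · simpa [hμ0] using e3'
  · simpa [hμ0] using e4'

/-- **The fold map has injective differential off the unknot** (chain rule on
`ι ∘ q = (F/‖F‖) ∘ ι`, `ι : S⁴ ↪ ℝ⁵`, with `dι` injective onto `x^⊥`). [folklore] -/
theorem injective_mfderiv_fold {x : 𝕊 4} (hx : tailTwo (x : 𝔼 5) ≠ 0) :
    Injective (mfderiv (𝓡 4) (𝓡 4) fold x) := by
  set G : 𝔼 5 → 𝔼 5 := fun z ↦ NormedSpace.normalize (foldVec z) with hGdef
  have hGd : DifferentiableAt ℝ G x :=
    ((contDiffAt_normalize (foldVec_ne_zero x)).comp _ contDiff_foldVec.contDiffAt).differentiableAt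
      (by simp)
  have hval : MDifferentiableAt (𝓡 4) 𝓘(ℝ, 𝔼 5) (Subtype.val : (𝕊 4) → 𝔼 5) (fold x) :=
    (contMDiff_coe_sphere (E := 𝔼 5) (n := 4) (m := ∞)).mdifferentiableAt (by simp)
  have hvalx : MDifferentiableAt (𝓡 4) 𝓘(ℝ, 𝔼 5) (Subtype.val : (𝕊 4) → 𝔼 5) x :=
    (contMDiff_coe_sphere (E := 𝔼 5) (n := 4) (m := ∞)).mdifferentiableAt (by simp)
  have hfold : MDifferentiableAt (𝓡 4) (𝓡 4) fold x := contMDiff_fold.mdifferentiableAt (by simp)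
  have h1 := mfderiv_comp x hval hfold
  have h2 := mfderiv_comp x hGd.mdifferentiableAt hvalx
  have h12 : (Subtype.val : (𝕊 4) → 𝔼 5) ∘ fold = G ∘ (Subtype.val : (𝕊 4) → 𝔼 5) := rfl
  rw [h12, h2, mfderiv_eq_fderiv] at h1
  -- `h1 : fderiv G x ∘ dι_x = dι_{q x} ∘ dq_x`
  set Dx := mfderiv (𝓡 4) 𝓘(ℝ, 𝔼 5) (Subtype.val : (𝕊 4) → 𝔼 5) x with hDx
  have hDx_inj : Injective Dx := mfderiv_coe_sphere_injective (E := 𝔼 5) (n := 4) x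
  refine (injective_iff_map_eq_zero _).2 fun v hv ↦ ?_
  set W : 𝔼 5 := Dx v with hW
  have hGW : fderiv ℝ G x W = 0 := by
    have := DFunLike.congr_fun h1 v
    change fderiv ℝ G x (Dx v) =
      mfderiv (𝓡 4) 𝓘(ℝ, 𝔼 5) (Subtype.val : (𝕊 4) → 𝔼 5) (fold x) (mfderiv (𝓡 4) (𝓡 4) fold x v)
      at this
    rw [hv, map_zero] at this
    exact this
  have horth : ⟪(x : 𝔼 5), W⟫_ℝ = 0 := by
    have hmem : W ∈ (ℝ ∙ (x : 𝔼 5))ᗮ := by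
      rw [← range_mfderiv_coe_sphere (E := 𝔼 5) (n := 4) x]
      exact ⟨v, rfl⟩
    exact (Submodule.mem_orthogonal_singleton_iff_inner_right).1 hmem
  have hW0 : W = 0 := eq_zero_of_fderiv_normalize_foldVec hx hGW horth
  exact hDx_inj (by rw [map_zero]; exact hW0)

/-- **The fold map is a local diffeomorphism off the unknotted 2-sphere** (inverse function
theorem on manifolds, `isLocalDiffeomorphAt_of_mfderiv_injective`). [folklore] -/
theorem isLocalDiffeomorphAt_fold {x : 𝕊 4} (hx : tailTwo (x : 𝔼 5) ≠ 0) :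
    IsLocalDiffeomorphAt (𝓡 4) (𝓡 4) ∞ fold x :=
  isLocalDiffeomorphAt_of_mfderiv_injective isOpen_univ (mem_univ x) contMDiff_fold.contMDiffOn
    (by exact_mod_cast le_top) rfl (injective_mfderiv_fold hx)

/-! ## The standard example -/

/-- **The 4-sphere with its linear half-turn is the branched double cover of itself along the
unknotted 2-sphere** (Miyazawa, arXiv:2312.02041, proof of Prop. 3.14: "`Σ₂(S⁴, U)` is
diffeomorphic to `S⁴` and the covering transformation … is induced by
`(x₁, x₂, x₃, x₄) ↦ (x₁, x₂, -x₃, -x₄)`"; the `s = 0` case of Kuhrman, arXiv:2507.03798, Thm. 1):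
`IsBranchedDoubleCover (𝓡 4) (𝕊 4) unknotTwo halfTurn fold`. In particular the relational
predicate `IsBranchedDoubleCover` of `BranchedDoubleCoverTwoKnot.lean` is inhabited.
[cite: Miyazawa2023, proof of Prop. 3.14 (p. 24)] -/
theorem isBranchedDoubleCover_sphere_unknotTwo :
    IsBranchedDoubleCover (𝓡 4) (𝕊 4) unknotTwo halfTurn fold where
  contMDiff_proj := contMDiff_fold
  contMDiff_deck := contMDiff_halfTurn
  proj_deck := fold_halfTurn
  eq_or_eq_deck_of_proj_eq _ _ h := eq_or_eq_halfTurn_of_fold_eq h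
  proj_surjective := fold_surjective
  deck_ne_of_notMem x hx h := hx ((fold_mem_range_unknotTwo_iff x).2 ((halfTurn_eq_self_iff x).1 h))
  isLocalDiffeomorphAt_proj x hx :=
    isLocalDiffeomorphAt_fold fun h ↦ hx ((fold_mem_range_unknotTwo_iff x).2 h)
  exists_model := ⟨unknotTube, modelMap, isSmoothEmbedding_modelMap, isOpen_range_modelMap,
    fun p w ↦ by rw [unknotTube_toFun]; exact fold_modelMap p w, halfTurn_modelMap,
    by rw [unknotTube_toFun]; exact range_modelMap_eq_preimage⟩

end BranchedUnknot

end Literature.Topology.FourManifolds
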